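import Summits.Ventures.Crystal3D.Theorems.StickyWulffConstantCoaxialWallLawAzimuthSchedulingFwd
import Summits.Ventures.Crystal3D.Theorems.StickyWulffConstantCoaxialWallLawMidPlanarKey
import HarnessLib

/-!
# Kernel sub-certificates (F) of the planar-heights kissing row on `τ ∈ [0.345, 0.655]` (`decide +kernel`, standard axioms)

HONEST FRAMING. Part of the venture `Summits/Ventures/Crystal3D` (cell `crystal3d-full`), helper
`--supports` the crux `CoaxialWallLaw` (stmt-Ventures-19481, `route-Ventures-StickyWulffConstant`),
REGISTERED line `WallLedgerF`, open stub `stub_coaxialTwoSlabAdhesion`.  RUNG CREDIT ONLY; F-C1 not moved.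

Depth-2 subtrees `[0,3,2]`, `[0,3,3]` of the certificate `azSearchF mpTbl 62832 [5,12,12,12,12] 0 12 = true` for the interval
table `mpTbl` (`…MidPlanarKey`), evaluated IN THE KERNEL; `…MidPlanarCert` assembles the 25 of them (files A … J).
-/

namespace Summit.Ventures.Crystal3D.Theorems

/-- Kernel sub-certificate (interval table) for the prefix `[0, 3, 2]` (forward positions `[0, 5235, 9300]`). -/
theorem mp_kcert_32 :
    azSearchFGo mpTbl 62832 [5, 12, 12, 12, 12] 9 [0, 3, 2] [0, 5235, 9300] = true := by
  decide +kernel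

/-- Kernel sub-certificate (interval table) for the prefix `[0, 3, 3]` (forward positions `[0, 5235, 26178]`). -/
theorem mp_kcert_33 :
    azSearchFGo mpTbl 62832 [5, 12, 12, 12, 12] 9 [0, 3, 3] [0, 5235, 26178] = true := by
  decide +kernel

end Summit.Ventures.Crystal3D.Theorems
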